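import Summits.AtomisticToContinuum.HydrodynamicLimit.Theorems.StiffCollisionalRelaxationAprioriBoundsMesoTwoPtTruncated
import Summits.AtomisticToContinuum.HydrodynamicLimit.Theorems.StiffCollisionalRelaxationAprioriBoundsMesoVarianceTimeZeroBridge
import Summits.AtomisticToContinuum.HydrodynamicLimit.Theorems.StiffCollisionalRelaxationAprioriBoundsMesoRatioLipschitz
import HarnessLib

/-!
# Poisson-order variance of the kernel block density at time zero for every nice profile (s = 0 inhomogeneous
# rung of stub `stub_mesoVariance`, line `meso-chebyshev-window`, crux `AprioriBounds`, stmt-AtomisticToContinuum-14827)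

Helper file (`--supports stmt-AtomisticToContinuum-14827`).  Stub 3 of the line asks, under the crux prefix, for
`Var_{P_N} ρ̄_φ(s,x) ≤ A (N+1)^{3γ−1}` — POISSON ORDER — for the kernel block density
`ρ̄_φ(s,x)(z) = empiricalDensityField ((Φ N).flow s z) (fun y => φ N (y - x))` under the local Gibbs law
`P_N = localGibbsLaw σ a₀ u₀ θ₀ N (Φ N)`.  This file assembles the `s = 0` estimate for GENERAL continuous positive
profiles from the three landed ingredients

* plumbing (p164204, `…MesoVarianceTimeZeroBridge`): `Var_{P_N} ρ̄_φ(0,x) = Var_{posGibbs}((N+1)⁻¹∑ᵢ χ(qᵢ))`,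
  `χ = φ(· − x)`, and `Var_{posGibbs} ≤ (N+1)⁻¹·2K∫χdμ + |E[χ(x₀)χ(x₁)] − E[χ(x₀)]²|`;
* the quantitative truncated two-point function (p164308, `…MesoTwoPtTruncated`):
  `|E[χχ] − E[χ]²| ≤ (∫|χ|dμ)·K·B_N(δ)` given a level-Lipschitz bound `δ` on the insertion ratios;
* `∫ χ dμ ≤ M` for a kernel of unit mass (`LGFS.integral_kernel_μ_le`),

into `tzVar_variance_blockDensity_flow_zero_le`:
`Var_{P_N} ρ̄_φ(0,x) ≤ K·M·(2/(N+1) + B_N(δ))`, `B_N(δ) = 2eS(K₁/(N+1) + 2eSδ) + 8e²Sλ/(N+1)`, for every hard-sphere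
flow, every `N ≥ 1`, every continuous kernel `0 ≤ φ ≤ K` of unit mass and every centre `x`, at small density
(`SmallDensity (profileOf a₀) σ`).  With `δ = O(λ/(N+1))` (`…MesoRatioLipschitz`) and `K = C(N+1)^{3γ}` this is
`A(N+1)^{3γ−1}`: the ANCHOR `mesoVariance_timeZero` — the registered stub's conclusion block at `s = 0` for EVERY continuous
positive profile (the equilibrium rung `mesoVariance_homogeneous`, p148322, was constant profiles at all times).  No definitions,
no named facts; axioms standard.  References: E. Pulvirenti, D. Tsagkarogiannis, Comm. Math. Phys. 316 (2012) §3–5;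
D. Ruelle, *Statistical Mechanics* (1969) §4.2; H. Spohn, *Large Scale Dynamics of Interacting Particles* (1991) I §2.3, II §7.
-/

noncomputable section

namespace Summit.AtomisticToContinuum.HydrodynamicLimit.Theorems.MesoChebyshevWindow

open MeasureTheory ProbabilityTheory Finset Filter Topology
open Literature.Probability.LatticeModels Literature.MathematicalPhysics.StatisticalMechanics
  Literature.MathematicalPhysics.KineticTheory Literature.Analysis.FluidPDE

/-- **Variance of the kernel block density at time zero, general profiles, modulo the ratio-Lipschitz bound.**
For continuous positive profiles, small density (`SmallDensity (profileOf a₀) σ`), `N ≥ 1`, any hard-sphere flow `Φ`,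
a continuous kernel `0 ≤ φ ≤ K` of unit mass, a centre `x` and a level-Lipschitz bound `δ ≥ 0` for the insertion
ratios of the canonical gas (`|q_N(k+1) − q_N(k)| ≤ δ`, `k + 1 ≤ N`):
`Var_{P_N} ρ̄_φ(0,x) ≤ K·M·(2/(N+1) + 2eS(K₁/(N+1) + 2eSδ) + 8e²Sλ/(N+1))`,
`M = sup a₀/∫a₀`, `S = θ/(1−θ)² + (1−θ)⁻¹`, `K₁ = 4e²λS + 2eθ/(1−θ)²`. -/
theorem tzVar_variance_blockDensity_flow_zero_le {σ : ℝ} {a₀ θ₀ : T3 → ℝ} {u₀ : T3 → V3}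
    (ha : Continuous a₀) (hθ : Continuous θ₀) (hu : Continuous u₀) (ha0 : ∀ x, 0 < a₀ x) (hθ0 : ∀ x, 0 < θ₀ x)
    (hs : SmallDensity (profileOf a₀ ha ha0) σ) {N : ℕ} (hN : 1 ≤ N)
    (Φ : HardSphereFlow (Torus.geometry (Fin 3)) (hsDiameter σ N) (N + 1)) {φ : T3 → ℝ} (hφ : Continuous φ)
    {K : ℝ} (hφ0 : ∀ y, 0 ≤ φ y) (hφK : ∀ y, φ y ≤ K) (hφ1 : ∫ y, φ y = 1) (x : T3) {δ : ℝ} (hδ : 0 ≤ δ)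
    (hq : ∀ k, k + 1 ≤ N →
      |qN (profileOf a₀ ha ha0) σ N (k + 1) - qN (profileOf a₀ ha ha0) σ N k| ≤ δ) :
    variance (fun z => empiricalDensityField (Φ.flow 0 z) (fun y => φ (y - x))) (localGibbsLaw σ a₀ u₀ θ₀ N Φ) ≤
      K * (profileOf a₀ ha ha0).M *
        (2 / ((N : ℝ) + 1) +
          (2 * Real.exp 1 * (geomRatio (profileOf a₀ ha ha0) σ / (1 - geomRatio (profileOf a₀ ha ha0) σ) ^ 2 +
                (1 - geomRatio (profileOf a₀ ha ha0) σ)⁻¹) *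
              ((4 * Real.exp 1 ^ 2 * ovDensity (profileOf a₀ ha ha0) σ *
                    (geomRatio (profileOf a₀ ha ha0) σ / (1 - geomRatio (profileOf a₀ ha ha0) σ) ^ 2 +
                      (1 - geomRatio (profileOf a₀ ha ha0) σ)⁻¹) +
                  2 * Real.exp 1 *
                    (geomRatio (profileOf a₀ ha ha0) σ / (1 - geomRatio (profileOf a₀ ha ha0) σ) ^ 2)) /
                  ((N : ℝ) + 1) +
                2 * Real.exp 1 * (geomRatio (profileOf a₀ ha ha0) σ / (1 - geomRatio (profileOf a₀ ha ha0) σ) ^ 2 +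
                  (1 - geomRatio (profileOf a₀ ha ha0) σ)⁻¹) * δ) +
            8 * Real.exp 1 ^ 2 * (geomRatio (profileOf a₀ ha ha0) σ / (1 - geomRatio (profileOf a₀ ha ha0) σ) ^ 2 +
                (1 - geomRatio (profileOf a₀ ha ha0) σ)⁻¹) * ovDensity (profileOf a₀ ha ha0) σ / ((N : ℝ) + 1))) := by
  set P := profileOf a₀ ha ha0 with hP
  set χ : T3 → ℝ := fun y => φ (y - x) with hχdef
  have hχc : Continuous χ := hφ.comp (continuous_sub_right x)
  have hχm : Measurable χ := hχc.measurable
  have hχ0 : ∀ y, 0 ≤ χ y := fun y => hφ0 _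
  have hχK : ∀ y, χ y ≤ K := fun y => hφK _
  have hχabs : ∀ y, |χ y| ≤ K := LGFS.abs_le_of_nonneg_of_le hχ0 hχK
  have hχ1 : ∫ y, χ y = 1 := MesoLLN.integral_translate_eq_one' hφ1 x
  have hK0 : 0 ≤ K := (hφ0 x).trans (hφK x)
  have hM := P.M_pos
  have hg0 := hs.geomRatio_nonneg
  have hg1 := hs.geomRatio_lt_one
  have hl0 := hs.ovDensity_nonneg
  have hN0 : (0 : ℝ) < (N : ℝ) + 1 := by positivity
  -- (e1) law at time zero → canonical gas
  have h1 := tzVar_variance_blockDensity_flow_zero_eq ha hθ hu ha0 hθ0 N Φ hφ x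
  -- (d) variance under the canonical gas
  have h2 : variance (fun q : Fin (N + 1) → T3 => (((N + 1 : ℕ) : ℝ))⁻¹ * ∑ i, φ (q i - x))
      (posGibbsMeasure a₀ (hsDiameter σ N) (N + 1)) ≤
      (((N + 1 : ℕ) : ℝ))⁻¹ * (2 * K * ∫ y, χ y ∂P.μ) + |twoPt P σ χ N - onePt P σ χ N 0 ^ 2| :=
    tzVar_variance_avg_posGibbs_le (χ := χ) ha ha0 hs hN hχm hχ0 hχK
  -- (c) the truncated two-point function
  have h3 := tpt_abs_twoPt_sub_sq_le hs hχm hχabs hN hδ hq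
  -- masses
  have hI1 : ∫ y, χ y ∂P.μ ≤ P.M := LGFS.integral_kernel_μ_le P hχm hχ0 hχK hχ1
  have hI2 : ∫ y, |χ y| ∂P.μ ≤ P.M := LGFS.integral_abs_kernel_μ_le P hχm hχ0 hχK hχ1
  have hIn : 0 ≤ ∫ y, χ y ∂P.μ := integral_nonneg hχ0
  -- the bracket is nonnegative
  set S := geomRatio P σ / (1 - geomRatio P σ) ^ 2 + (1 - geomRatio P σ)⁻¹ with hS
  have hS0 : 0 ≤ S := tpt_S_nonneg hs
  set B : ℝ := 2 * Real.exp 1 * S *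
      ((4 * Real.exp 1 ^ 2 * ovDensity P σ * S + 2 * Real.exp 1 * (geomRatio P σ / (1 - geomRatio P σ) ^ 2)) /
          ((N : ℝ) + 1) + 2 * Real.exp 1 * S * δ) +
    8 * Real.exp 1 ^ 2 * S * ovDensity P σ / ((N : ℝ) + 1) with hB
  have hB0 : 0 ≤ B := by
    rw [hB]
    have : 0 < 1 - geomRatio P σ := by linarith
    positivity
  have hcast : (((N + 1 : ℕ) : ℝ))⁻¹ = 1 / ((N : ℝ) + 1) := by push_cast; rw [one_div]
  rw [h1]
  calc variance (fun q : Fin (N + 1) → T3 => (((N + 1 : ℕ) : ℝ))⁻¹ * ∑ i, φ (q i - x))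
        (posGibbsMeasure a₀ (hsDiameter σ N) (N + 1))
      ≤ (((N + 1 : ℕ) : ℝ))⁻¹ * (2 * K * ∫ y, χ y ∂P.μ) + |twoPt P σ χ N - onePt P σ χ N 0 ^ 2| := h2
    _ ≤ (1 / ((N : ℝ) + 1)) * (2 * K * P.M) + P.M * K * B := by
        rw [hcast]
        refine add_le_add (mul_le_mul_of_nonneg_left (by nlinarith) (by positivity)) (h3.trans ?_)
        exact mul_le_mul_of_nonneg_right (mul_le_mul_of_nonneg_right hI2 hK0) hB0
    _ = K * P.M * (2 / ((N : ℝ) + 1) + B) := by ring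

/-! ## The anchor: stub `stub_mesoVariance` at `s = 0` for every nice profile -/

/-- **`stub_mesoVariance` AT TIME ZERO, FOR EVERY NICE (INHOMOGENEOUS) PROFILE, EVERY FLOW FAMILY** (anchor
`mesoVariance_timeZero` of the line `meso-chebyshev-window`: the registered stub's conclusion block at `s = 0`, with the
crux prefix reduced to what is used — continuity/positivity of the profiles and `σ < σ₀`).  There is `σ₀ > 0`
(`exists_smallDensity (profileOf a₀)`: the low-density regime of the canonical cluster expansion, intersected with `1/2`)
such that for `0 < σ < σ₀`, EVERY flow family, every `γ > 0` and every admissible kernel family, with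
`A := C·M·(2 + 2eS(K₁ + 2eS·D_q·λ) + 8e²Sλ)` (`M = sup a₀/∫a₀`, `λ = Mv₁σ³`, `θ = 2eλ`, `S = θ/(1−θ)² + (1−θ)⁻¹`,
`K₁ = 4e²λS + 2eθ/(1−θ)²`, `D_q = 32e²/(1−θ)²`) and `N₀ := 1`: for all `N ≥ 1` and all centres `x`, the block density
`ρ̄_φ(0,x)` is in `L²(P_N)` and `Var_{P_N} ρ̄_φ(0,x) ≤ A (N+1)^{3γ−1}` — POISSON ORDER for the inhomogeneous local Gibbs
state.  Ingredients: `tzVar_variance_blockDensity_flow_zero_le` with `K = C(N+1)^{3γ}` and the level-Lipschitz bound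
`δ = D_q λ/(N+1)` of `ratioLip_qN_succ_sub_le` (p164392).  Only continuity (from smoothness), positivity, unit mass
and the height bound of the kernel block are used; `γ ≤ 1/15`, the support and gradient clauses are idle. -/
theorem mesoVariance_timeZero : ∀ (a₀ θ₀ : T3 → ℝ) (u₀ : T3 → V3), Continuous a₀ → Continuous θ₀ → Continuous u₀ → (∀ x, 0 < a₀ x) → (∀ x, 0 < θ₀ x) → ∃ σ₀ : ℝ, 0 < σ₀ ∧ ∀ σ : ℝ, 0 < σ → σ < σ₀ → ∀ (Φ : (N : ℕ) → HardSphereFlow (Torus.geometry (Fin 3)) (hsDiameter σ N) (N + 1)) (γ C : ℝ) (φ : ℕ → T3 → ℝ), 0 < γ → γ ≤ 1 / 15 → ((∀ N, Literature.Analysis.FunctionSpaces.Torus.IsSmooth (φ N)) ∧ (∀ N y, 0 ≤ φ N y) ∧ (∀ N, ∫ y, φ N y = 1) ∧ (∀ (N : ℕ) y, ((N : ℝ) + 1) ^ (-γ) ≤ Torus.euclidDist y 0 → φ N y = 0) ∧ (∀ (N : ℕ) y, φ N y ≤ C * ((N : ℝ) + 1) ^ (3 * γ)) ∧ (∀ (N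 : ℕ) y, ‖Literature.Analysis.FunctionSpaces.Torus.gradient (φ N) y‖ ≤ C * ((N : ℝ) + 1) ^ (4 * γ))) → ∃ A : ℝ, ∃ N₀ : ℕ, ∀ N : ℕ, N₀ ≤ N → ∀ x : T3, MemLp (fun z => empiricalDensityField ((Φ N).flow 0 z) (fun y => φ N (y - x))) 2 (localGibbsLaw σ a₀ u₀ θ₀ N (Φ N)) ∧ variance (fun z => empiricalDensityField ((Φ N).flow 0 z) (fun y => φ N (y - x))) (localGibbsLaw σ a₀ u₀ θ₀ N (Φ N)) ≤ A * ((N : ℝ) + 1) ^ (3 * γ - 1) := by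
  intro a₀ θ₀ u₀ ha hθ hu ha0 hθ0
  obtain ⟨σ₁, hσ₁, hsd⟩ := exists_smallDensity (profileOf a₀ ha ha0) one_pos
  refine ⟨min σ₁ (1 / 2), lt_min hσ₁ one_half_pos, ?_⟩
  intro σ hσ hσlt Φ γ C φ _ _ hadm
  obtain ⟨hsm, hpos, hmass, -, hle, -⟩ := hadm
  have hs : SmallDensity (profileOf a₀ ha ha0) σ := (hsd σ hσ (hσlt.trans_le (min_le_left _ _))).1
  have hσ2 : σ ≤ 1 / 2 := (hσlt.trans_le (min_le_right _ _)).le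
  have hg0 := hs.geomRatio_nonneg
  have hg1 := hs.geomRatio_lt_one
  have hl0 := hs.ovDensity_nonneg
  have h1θ : 0 < 1 - geomRatio (profileOf a₀ ha ha0) σ := by linarith
  refine ⟨C * (profileOf a₀ ha ha0).M * (2 + (2 * Real.exp 1 * (geomRatio (profileOf a₀ ha ha0) σ / (1 - geomRatio (profileOf a₀ ha ha0) σ) ^ 2 + (1 - geomRatio (profileOf a₀ ha ha0) σ)⁻¹) * (4 * Real.exp 1 ^ 2 * ovDensity (profileOf a₀ ha ha0) σ * (geomRatio (profileOf a₀ ha ha0) σ / (1 - geomRatio (profileOf a₀ ha ha0) σ) ^ 2 + (1 - geomRatio (profileOf a₀ ha ha0) σ)⁻¹) + 2 * Real.exp 1 * (geomRatio (profileOf a₀ ha ha0) σ / (1 - geomRatio (profileOf a₀ ha ha0) σ) ^ 2) + 2 * Real.exp 1 * (geomRatio (profileOf a₀ ha ha0) σ / (1 - geomRatio (profileOf a₀ ha ha0) σ) ^ 2 + (1 - geomRatio (profileOf a₀ ha ha0) σ)⁻¹) * ((32 * Real.exp 1 ^ 2 / (1 - geomRatio (profileOf a₀ ha ha0) σ) ^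 2) * ovDensity (profileOf a₀ ha ha0) σ)) + 8 * Real.exp 1 ^ 2 * (geomRatio (profileOf a₀ ha ha0) σ / (1 - geomRatio (profileOf a₀ ha ha0) σ) ^ 2 + (1 - geomRatio (profileOf a₀ ha ha0) σ)⁻¹) * ovDensity (profileOf a₀ ha ha0) σ)), 1, fun N hN x => ?_⟩
  have hN0 : (0 : ℝ) < (N : ℝ) + 1 := by positivity
  have hK : ∀ y, |φ N y| ≤ C * ((N : ℝ) + 1) ^ (3 * γ) := fun y =>
    abs_le.2 ⟨by linarith [hpos N y, hle N y], hle N y⟩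
  refine ⟨tzVar_memLp_blockDensity_flow hσ2 ha hθ hu ha0 hθ0 N (Φ N) (hsm N).continuous hK 0 x, ?_⟩
  -- the level-Lipschitz bound with `δ = D_q λ/(N+1)` (p164392)
  have hδ0 : 0 ≤ (32 * Real.exp 1 ^ 2 / (1 - geomRatio (profileOf a₀ ha ha0) σ) ^ 2) * (ovDensity (profileOf a₀ ha ha0) σ / ((N : ℝ) + 1)) := by positivity
  have hq : ∀ k, k + 1 ≤ N → |qN (profileOf a₀ ha ha0) σ N (k + 1) - qN (profileOf a₀ ha ha0) σ N k| ≤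
      (32 * Real.exp 1 ^ 2 / (1 - geomRatio (profileOf a₀ ha ha0) σ) ^ 2) * (ovDensity (profileOf a₀ ha ha0) σ / ((N : ℝ) + 1)) :=
    fun k hk => ratioLip_qN_succ_sub_le hs hk
  have hv := tzVar_variance_blockDensity_flow_zero_le ha hθ hu ha0 hθ0 hs hN (Φ N) (hsm N).continuous
    (hpos N) (hle N) (hmass N) x hδ0 hq
  refine hv.trans (le_of_eq ?_)
  rw [Real.rpow_sub hN0, Real.rpow_one]
  have hθne : (1 : ℝ) - geomRatio (profileOf a₀ ha ha0) σ ≠ 0 := h1θ.ne'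
  have hnne : ((N : ℝ) + 1) ≠ 0 := hN0.ne'
  generalize geomRatio (profileOf a₀ ha ha0) σ = θ at hθne ⊢
  generalize ovDensity (profileOf a₀ ha ha0) σ = lam
  generalize (profileOf a₀ ha ha0).M = M
  generalize ((N : ℝ) + 1) ^ (3 * γ) = pw
  generalize ((N : ℝ) + 1) = n at hnne ⊢
  field_simp

end Summit.AtomisticToContinuum.HydrodynamicLimit.Theorems.MesoChebyshevWindow

end
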